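import Summits.Ventures.HSemireg.WedgeBoxPurityRank
import Summits.Ventures.HSemireg.WedgePairRank
import Summits.Ventures.HSemireg.FormulaNUniformKernel

/-!
# Venture HSemireg — the KERNEL of `θ ↦ θ ∧ (f₁ ∧ f₂)` AS A SUBSPACE in th-7's wedge model (STRUCTURE C4's NAME, uniformly in `n`):
# below the middle degree it is spanned by the KILLED monomials; in degree 2 these are the `2n²` split-deformation directions

HONEST FRAMING. Part of the Lean index of the computation cell `pub-hsemireg` (seat p10 gen 2, Sunday typer «UNIFORM-IN-n»).
Finite-dimensional EXTERIOR ALGEBRA over a field ONLY: no variety, no cohomology theory, no sheaf, no semiregularity map is constructed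
here; nothing here says that HC / HC_CM / HC_AV holds; no Literature fact is declared or used.

STRUCTURE.md v1.0-SIGNED §1.1 C4 («ker ⌟ch(G) on HT²(Y) … DIMENSION 2n² uniform … IDENTIFIED — name now ×3 (GS v0.1 · gs-eng-1 g8
THEOREM M «ker 2n² = H¹(T_X) ⊗ 1 ⊕ 1 ⊗ H¹(T_X′)» · th-7 Cor A.4: the mixed H¹(T)-block of ⌟(1 − pt) has rank 0)») and §2 (S1)
(«dim ker ⌟ch(E) on HT²(A) = 2n² UNIFORMLY (n ≥ 3 …), and AS A SUBSPACE ker = Φ_*(ker of the SOURCE box) — for point-type sources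
I_p ⊠ I_q literally the split-deformation piece H¹(T_X) ⊕ H¹(T_{X′})»).  `FormulaNUniformKernel.lean` (p10 g0) typed the DIMENSION
(`finrank_ker_box_eq_kerDim`, all `n`, `k ≤ 2n`); the SUBSPACE was on the honest «not typed» list.  Here, in th-7's model
(`WedgeBox*.lean`: generators `X = A 0`, `Y = A 1`, `X′ = C 0`, `Y′ = C 1`, box `Σ c_{αβ} E_{Aα ∪ Cβ}`, relevant monomials `Rel n k` =
those inside some `Aα ∪ Cβ`):
* `killed n k` := the degree-`k` monomials NOT in `Rel n k` — equivalently (`mem_killed_iff`) those meeting BOTH blocks of factor 1 or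
  BOTH blocks of factor 2; each is annihilated by the box (`B_mul_boxClass_eq_zero_of_mem_killed`);
* **`map_ker_wedgeMap_eq_span_killed`**: for `k < n` and all `c_{αβ} ≠ 0`, the kernel of `θ ↦ θ ∧ box` on `⋀^k K^{4n}` IS the span
  of the killed monomials (⊇ directly; `=` by th-7's rank `|Rel n k|` (`finrank_range_eq_card_Rel`) and rank–nullity:
  `|killed| = C(4n,k) − |Rel|`) — no binomial kernel vectors below the middle degree (in degree `n` th-7's purity drop adds some);
* **degree 2 = C4's NAME** (`killed_two_eq`, `card_killed_two`, `map_ker_wedgeMap_two_eq_span`): for `n ≥ 3` the killed 2-monomials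
  are exactly the `n² + n²` products `x ∧ y` (`x ∈ X`, `y ∈ Y`) and `x′ ∧ y′` — in the dictionary (th-7 PART B §A.3, quoted not asserted:
  `X ↔ H⁰(T_X)`-, `Y ↔ H¹(𝒪_X)`-directions) the pieces `H⁰(T_X) ⊗ H¹(𝒪_X) = H¹(T_X)`-type ⊕ the same for `X′`: «ker = H¹(T_X) ⊗ 1 ⊕
  1 ⊗ H¹(T_X′)», `2n²`, for EVERY `n ≥ 3`, and the honest box `fac1 a * fac2 a′`.
* the FACTOR (th-7's one-factor model `WedgePair`): **`map_ker_wedgeMap_pointPair_eq_span_mixed`** — for `0 < k < n` the kernel of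
  `θ ↦ θ ∧ (a E_X + c E_Y)` on `⋀^k K^{2n}` is the span of the MIXED monomials (meeting `X` and `Y`), dimension `C(2n,k) − 2C(n,k)`
  (th-7 Cor A.4 «the mixed H¹(T)-block of ⌟(1 − pt) has rank 0», as a subspace statement; rank `2C(n,k)` = th-7's THEOREM T,
  `finrank_range_wedgeMap_pointPair_mid`); degree 2: `card_mixed_two` — the `n²` pairs `x ∧ y`, C6's factor kernel `n²`.
-/

open Module Set Set.powersetCard Finset

namespace Summit.Ventures.HSemireg.WedgeBox

variable (K : Type*) [Field K] {n k : ℕ}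

/-! ## The killed monomials -/

/-- the KILLED monomials of degree `k`: `|s| = k` and `s` is not relevant (not inside any `Aα ∪ Cβ`). -/
def killed (n k : ℕ) : Finset (Finset (I n)) := (Finset.univ.powersetCard k) \ Rel n k

/-- membership in `killed`. -/
lemma mem_killed {s : Finset (I n)} : s ∈ killed n k ↔ s.card = k ∧ s ∉ Rel n k := by
  simp [killed, Finset.mem_powersetCard]

/-- a killed monomial is disjoint from NO `Aα ∪ Cβ`. -/
lemma not_disjoint_of_mem_killed {s : Finset (I n)} (hs : s ∈ killed n k) (α β : Fin 2) : ¬ Disjoint s (P n α β) :=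
  fun hd => (mem_killed.mp hs).2 (mem_Rel_of_disjoint (mem_killed.mp hs).1 hd)

/-- **killed ⟺ meets both blocks of one factor**: a degree-`k` monomial is killed iff it meets `X` and `Y`, or `X′` and `Y′`
(degree 2, `n ≥ 3`: exactly the products `x ∧ y`, `x′ ∧ y′` — C4's «H¹(T_X) ⊕ H¹(T_X′)» directions). -/
lemma mem_killed_iff {s : Finset (I n)} :
    s ∈ killed n k ↔ s.card = k ∧
      ((¬ Disjoint s (A n 0) ∧ ¬ Disjoint s (A n 1)) ∨ (¬ Disjoint s (C n 0) ∧ ¬ Disjoint s (C n 1))) := by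
  rw [mem_killed]
  refine ⟨fun ⟨hc, hR⟩ => ⟨hc, ?_⟩, fun ⟨hc, h⟩ => ⟨hc, fun hR => ?_⟩⟩
  · by_contra h
    simp only [not_or, not_and_or, not_not] at h
    obtain ⟨hA, hC⟩ := h
    have hα : ∃ α, Disjoint s (A n α) := hA.elim (fun h => ⟨0, h⟩) (fun h => ⟨1, h⟩)
    have hβ : ∃ β, Disjoint s (C n β) := hC.elim (fun h => ⟨0, h⟩) (fun h => ⟨1, h⟩)
    obtain ⟨α, hα⟩ := hα
    obtain ⟨β, hβ⟩ := hβ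
    exact hR (mem_Rel_of_disjoint hc ((disjoint_P_iff n).mpr ⟨hα, hβ⟩))
  · obtain ⟨α, β, hsub⟩ := subset_P_of_mem_Rel hR
    have hA := disjoint_A_of_subset_P hsub
    have hC := disjoint_C_of_subset_P hsub
    rcases h with ⟨h0, h1⟩ | ⟨h0, h1⟩
    · have : other α = 0 ∨ other α = 1 := by omega
      rcases this with e | e
      · exact h0 (e ▸ hA)
      · exact h1 (e ▸ hA)
    · have : other β = 0 ∨ other β = 1 := by omega
      rcases this with e | e
      · exact h0 (e ▸ hC)
      · exact h1 (e ▸ hC)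

/-- a killed monomial is annihilated by the box. -/
lemma B_mul_boxClass_eq_zero_of_mem_killed (c : Fin 2 → Fin 2 → K) {s : Finset (I n)} (hs : s ∈ killed n k) :
    B K n s * boxClass K n c = 0 := by
  have h := B_mul_boxClass K c ⟨s, mem_iff.mpr (mem_killed.mp hs).1⟩
  rw [show ((⟨s, mem_iff.mpr (mem_killed.mp hs).1⟩ : powersetCard (I n) k) : Finset (I n)) = s from rfl] at h
  rw [h]
  refine Finset.sum_eq_zero fun α _ => Finset.sum_eq_zero fun β _ => ?_
  rw [sgn_of_not_disjoint K (not_disjoint_of_mem_killed hs α β), mul_zero, zero_smul]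

/-- `|killed n k| + |Rel n k| = C(4n, k)`. -/
lemma card_killed_add (k : ℕ) : (killed n k).card + (Rel n k).card = (n + n + n + n).choose k := by
  have hsub : Rel n k ⊆ Finset.univ.powersetCard k := fun s hs =>
    Finset.mem_powersetCard.mpr ⟨Finset.subset_univ _, card_of_mem_Rel hs⟩
  rw [killed, Finset.card_sdiff_of_subset hsub, Nat.sub_add_cancel (Finset.card_le_card hsub), Finset.card_powersetCard,
    Finset.card_univ, Fintype.card_fin]

/-! ## The kernel below the middle degree is the span of the killed monomials -/

variable (c : Fin 2 → Fin 2 → K)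

/-- the killed monomials lie in the kernel. -/
lemma span_killed_le_map_ker :
    Submodule.span K (Set.range fun s : killed n k => (B K n s.1 : HT K n)) ≤
      (LinearMap.ker (wedgeMap K n k (boxClass K n c))).map (⋀[K]^k (N K n)).subtype := by
  rw [Submodule.span_le]
  rintro _ ⟨⟨s, hs⟩, rfl⟩
  have hmem : (B K n s : HT K n) ∈ ⋀[K]^k (N K n) := B_mem_exteriorPower K ⟨s, mem_iff.mpr (mem_killed.mp hs).1⟩
  refine ⟨⟨B K n s, hmem⟩, ?_, rfl⟩
  rw [SetLike.mem_coe, LinearMap.mem_ker, wedgeMap_apply]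
  exact B_mul_boxClass_eq_zero_of_mem_killed K c hs

/-- **THE KERNEL AS A SUBSPACE, `k < n`**: for all `c_{αβ} ≠ 0`, `ker(θ ↦ θ ∧ box ∣ ⋀^k K^{4n}) = span{E_s : s killed}` (as a
subspace of `⋀ K^{4n}`), of dimension `C(4n,k) − |Rel n k|` — no kernel vector below the middle degree is a genuine combination of
relevant monomials (th-7's `finrank_range_eq_card_Rel` + rank–nullity). -/
theorem map_ker_wedgeMap_eq_span_killed (hkn : k < n) (hc : ∀ α β, c α β ≠ 0) :
    (LinearMap.ker (wedgeMap K n k (boxClass K n c))).map (⋀[K]^k (N K n)).subtype =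
      Submodule.span K (Set.range fun s : killed n k => (B K n s.1 : HT K n)) := by
  have hli : LinearIndependent K (fun s : killed n k => (B K n s.1 : HT K n)) :=
    (B K n).linearIndependent.comp (fun s : killed n k => s.1) fun s s' h => Subtype.ext h
  refine (Submodule.eq_of_le_of_finrank_eq (span_killed_le_map_ker K c) ?_).symm
  rw [finrank_span_eq_card hli, Fintype.card_coe, Submodule.finrank_map_subtype_eq]
  have h1 := LinearMap.finrank_range_add_finrank_ker (wedgeMap K n k (boxClass K n c))
  rw [finrank_range_eq_card_Rel K c hkn hc, FormulaN.Uniform.finrank_exteriorPower_eq_dimHT,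
    FormulaN.Uniform.dimHT, ← card_killed_add (n := n) k, add_comm] at h1
  exact (Nat.add_right_cancel h1).symm

/-- the honest-box form (`fac1 a * fac2 a′`, all `a_α, a′_β ≠ 0`). -/
theorem map_ker_wedgeMap_fac_mul_eq_span_killed (hkn : k < n) {a a' : Fin 2 → K}
    (ha : ∀ α, a α ≠ 0) (ha' : ∀ β, a' β ≠ 0) :
    (LinearMap.ker (wedgeMap K n k (fac1 K n a * fac2 K n a'))).map (⋀[K]^k (N K n)).subtype =
      Submodule.span K (Set.range fun s : killed n k => (B K n s.1 : HT K n)) := by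
  rw [fac1_mul_fac2]
  exact map_ker_wedgeMap_eq_span_killed K _ hkn (boxCoeff_ne_zero K ha ha')

/-! ## Degree 2: the killed monomials are the `2n²` products `x ∧ y`, `x′ ∧ y′` (C4's name) -/

/-- the degree-2 killed monomials: pairs `{x, y}` with `x ∈ X`, `y ∈ Y`, or `{x′, y′}` with `x′ ∈ X′`, `y′ ∈ Y′`. -/
def splitPairs (n : ℕ) : Finset (Finset (I n)) :=
  ((A n 0 ×ˢ A n 1).image fun p => {p.1, p.2}) ∪ ((C n 0 ×ˢ C n 1).image fun p => {p.1, p.2})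

/-- a pair `{x, y}` across the two blocks of a factor has two elements. -/
lemma card_pair_of_mem {x y : I n} {S T : Finset (I n)} (hd : Disjoint S T) (hx : x ∈ S) (hy : y ∈ T) :
    ({x, y} : Finset (I n)).card = 2 := by
  rw [Finset.card_pair]
  rintro rfl
  exact Finset.disjoint_left.mp hd hx hy

/-- **degree 2: killed = split pairs** (any `n`). -/
theorem killed_two_eq : killed n 2 = splitPairs n := by
  ext s
  rw [mem_killed_iff, splitPairs, Finset.mem_union, Finset.mem_image, Finset.mem_image]
  constructor
  · rintro ⟨hcard, h⟩
    rcases h with ⟨h0, h1⟩ | ⟨h0, h1⟩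
    · left
      obtain ⟨x, hxs, hxA⟩ := Finset.not_disjoint_iff.mp h0
      obtain ⟨y, hys, hyA⟩ := Finset.not_disjoint_iff.mp h1
      refine ⟨(x, y), Finset.mem_product.mpr ⟨hxA, hyA⟩, ?_⟩
      have hxy : x ≠ y := fun e => Finset.disjoint_left.mp (disjoint_A_A n (show (0 : Fin 2) ≠ 1 by decide)) hxA (e ▸ hyA)
      exact Finset.eq_of_subset_of_card_le (Finset.insert_subset hxs (Finset.singleton_subset_iff.mpr hys))
        (by rw [hcard, Finset.card_pair hxy])
    · right
      obtain ⟨x, hxs, hxC⟩ := Finset.not_disjoint_iff.mp h0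
      obtain ⟨y, hys, hyC⟩ := Finset.not_disjoint_iff.mp h1
      refine ⟨(x, y), Finset.mem_product.mpr ⟨hxC, hyC⟩, ?_⟩
      have hxy : x ≠ y := fun e => Finset.disjoint_left.mp (disjoint_C_C n (show (0 : Fin 2) ≠ 1 by decide)) hxC (e ▸ hyC)
      exact Finset.eq_of_subset_of_card_le (Finset.insert_subset hxs (Finset.singleton_subset_iff.mpr hys))
        (by rw [hcard, Finset.card_pair hxy])
  · rintro (⟨⟨x, y⟩, hp, rfl⟩ | ⟨⟨x, y⟩, hp, rfl⟩)
    · obtain ⟨hx, hy⟩ := Finset.mem_product.mp hp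
      refine ⟨card_pair_of_mem (disjoint_A_A n (show (0 : Fin 2) ≠ 1 by decide)) hx hy, Or.inl ⟨?_, ?_⟩⟩
      · exact Finset.not_disjoint_iff.mpr ⟨x, Finset.mem_insert_self _ _, hx⟩
      · exact Finset.not_disjoint_iff.mpr ⟨y, Finset.mem_insert_of_mem (Finset.mem_singleton_self _), hy⟩
    · obtain ⟨hx, hy⟩ := Finset.mem_product.mp hp
      refine ⟨card_pair_of_mem (disjoint_C_C n (show (0 : Fin 2) ≠ 1 by decide)) hx hy, Or.inr ⟨?_, ?_⟩⟩
      · exact Finset.not_disjoint_iff.mpr ⟨x, Finset.mem_insert_self _ _, hx⟩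
      · exact Finset.not_disjoint_iff.mpr ⟨y, Finset.mem_insert_of_mem (Finset.mem_singleton_self _), hy⟩

/-- **`|killed n 2| = 2n²`** for `n ≥ 3` (= `kerDim n 2`, C4's dimension; from th-7's `card_Rel` and `6n² − 2n`). -/
theorem card_killed_two (hn : 3 ≤ n) : (killed n 2).card = 2 * n ^ 2 := by
  have h1 := card_killed_add (n := n) 2
  have h2 := card_Rel (n := n) (k := 2) (by omega)
  have h3 := FormulaN.Uniform.boxRank_closed n 2
  have h4 := FormulaN.Uniform.kerDim_two hn
  have h5 := FormulaN.Uniform.kerDim_add_boxRank n 2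
  unfold FormulaN.Uniform.dimHT at h5
  simp only [show ¬ n ≤ 2 by omega, show (2 : ℕ) ≠ 0 by omega, show (2 : ℕ) ≠ n by omega,
    show (2 : ℕ) ≠ n + n by omega, if_false, mul_zero, add_zero] at h3
  omega

/-- **C4 AS A SUBSPACE, uniformly in `n ≥ 3`**: the kernel of `θ ↦ θ ∧ (f₁ ∧ f₂)` on `⋀² K^{4n}` is the span of the `2n²` split pairs
`x ∧ y` (`x ∈ X`, `y ∈ Y`) and `x′ ∧ y′` — «ker 2n² = H¹(T_X) ⊗ 1 ⊕ 1 ⊗ H¹(T_X′)» (GS THEOREM M / th-7 Cor A.4 / STRUCTURE C4, (S1)),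
in th-7's model, for the honest box with all factor coefficients non-zero. -/
theorem map_ker_wedgeMap_two_eq_span (hn : 3 ≤ n) {a a' : Fin 2 → K} (ha : ∀ α, a α ≠ 0) (ha' : ∀ β, a' β ≠ 0) :
    (LinearMap.ker (wedgeMap K n 2 (fac1 K n a * fac2 K n a'))).map (⋀[K]^2 (N K n)).subtype =
      Submodule.span K (Set.range fun s : splitPairs n => (B K n s.1 : HT K n)) ∧
    (splitPairs n).card = 2 * n ^ 2 := by
  rw [← killed_two_eq]
  exact ⟨map_ker_wedgeMap_fac_mul_eq_span_killed K (by omega) ha ha', card_killed_two hn⟩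

end Summit.Ventures.HSemireg.WedgeBox

/-! ## The FACTOR (th-7's `WedgePair` model): th-7 Cor A.4 — the kernel of `θ ↦ θ ∧ (a E_X + c E_Y)` below the top degree is the span
of the MIXED monomials; in degree 2 these are the `n²` pairs `x ∧ y` («H¹(T_X) = H⁰(T_X) ⊗ H¹(𝒪_X)», C6's factor kernel `n²`) -/

namespace Summit.Ventures.HSemireg.WedgePair

variable (K : Type*) [Field K] {n k : ℕ}

/-- the one-factor exterior algebra `⋀ K^{2n}` is finite-dimensional (monomial basis). -/
instance instFiniteHT_pair : Module.Finite K (HT K n) := Module.Finite.of_basis (B K n)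

/-- the MIXED monomials of degree `k`: those meeting both blocks `X` and `Y`. -/
def mixed (n k : ℕ) : Finset (Finset (I n)) :=
  (Finset.univ.powersetCard k).filter fun s => ¬ Disjoint s (Xset n) ∧ ¬ Disjoint s (Yset n)

/-- membership in `mixed`. -/
lemma mem_mixed {s : Finset (I n)} : s ∈ mixed n k ↔ s.card = k ∧ ¬ Disjoint s (Xset n) ∧ ¬ Disjoint s (Yset n) := by
  simp [mixed, Finset.mem_powersetCard]

/-- a mixed monomial is annihilated by the point pair (th-7 Cor A.4: «the mixed H¹(T)-block of ⌟(1 − pt) has rank 0»). -/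
lemma B_mul_pointPair_eq_zero_of_mixed (a c : K) {s : Finset (I n)} (hs : s ∈ mixed n k) :
    B K n s * pointPair K n a c = 0 := by
  obtain ⟨hc, hX, hY⟩ := mem_mixed.mp hs
  have h := B_mul_pointPair K ⟨s, mem_iff.mpr hc⟩ a c
  rw [B_mul_of_not_disjoint K ⟨s, mem_iff.mpr hc⟩ (Xpc n) hX, B_mul_of_not_disjoint K ⟨s, mem_iff.mpr hc⟩ (Ypc n) hY,
    smul_zero, smul_zero, add_zero] at h
  exact h

/-- the non-mixed degree-`k` monomials (`0 < k`) are the `k`-subsets of `X` and of `Y`: `|mixed| + 2·C(n,k) = C(2n,k)`. -/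
lemma card_mixed_add (hk : 0 < k) : (mixed n k).card + 2 * n.choose k = (n + n).choose k := by
  classical
  have hsplit : Finset.univ.powersetCard k =
      mixed n k ∪ ((Xset n).powersetCard k ∪ (Yset n).powersetCard k) := by
    ext s
    rw [Finset.mem_union, Finset.mem_union, mem_mixed, Finset.mem_powersetCard, Finset.mem_powersetCard,
      Finset.mem_powersetCard, ← disjoint_Y_iff_subset_X, ← disjoint_X_iff_subset_Y]
    constructor
    · rintro ⟨-, hc⟩
      by_cases hX : Disjoint s (Xset n)
      · exact Or.inr (Or.inr ⟨hX, hc⟩)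
      · by_cases hY : Disjoint s (Yset n)
        · exact Or.inr (Or.inl ⟨hY, hc⟩)
        · exact Or.inl ⟨hc, hX, hY⟩
    · rintro (⟨hc, -, -⟩ | ⟨-, hc⟩ | ⟨-, hc⟩) <;> exact ⟨Finset.subset_univ _, hc⟩
  have hd1 : Disjoint (mixed n k) ((Xset n).powersetCard k ∪ (Yset n).powersetCard k) := by
    rw [Finset.disjoint_left]
    intro s hs h
    rw [mem_mixed] at hs
    rw [Finset.mem_union, Finset.mem_powersetCard, Finset.mem_powersetCard, ← disjoint_Y_iff_subset_X,
      ← disjoint_X_iff_subset_Y] at h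
    rcases h with ⟨h, -⟩ | ⟨h, -⟩
    · exact hs.2.2 h
    · exact hs.2.1 h
  have hd2 : Disjoint ((Xset n).powersetCard k) ((Yset n).powersetCard k) := by
    rw [Finset.disjoint_left]
    intro s h1 h2
    rw [Finset.mem_powersetCard] at h1 h2
    have hne : s.Nonempty := by rw [← Finset.card_pos, h1.2]; exact hk
    obtain ⟨x, hx⟩ := hne
    exact Finset.disjoint_left.mp (disjoint_XY n) (h1.1 hx) (h2.1 hx)
  have h := congrArg Finset.card hsplit
  rw [Finset.card_union_of_disjoint hd1, Finset.card_union_of_disjoint hd2, Finset.card_powersetCard,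
    Finset.card_powersetCard, Finset.card_powersetCard, card_Xset, card_Yset, Finset.card_univ, Fintype.card_fin] at h
  omega

/-- **th-7 Cor A.4 AS A SUBSPACE (factor), `0 < k < n`**: the kernel of `θ ↦ θ ∧ (a E_X + c E_Y)` on `⋀^k K^{2n}` (`a, c ≠ 0`) is
the span of the mixed monomials, of dimension `C(2n,k) − 2·C(n,k)` (th-7's THEOREM T rank `2·C(n,k)` + rank–nullity). -/
theorem map_ker_wedgeMap_pointPair_eq_span_mixed (hk : 0 < k) (hkn : k < n) {a c : K} (ha : a ≠ 0) (hc : c ≠ 0) :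
    (LinearMap.ker (wedgeMap K n k (pointPair K n a c))).map (⋀[K]^k (N K n)).subtype =
      Submodule.span K (Set.range fun s : mixed n k => (B K n s.1 : HT K n)) := by
  have hli : LinearIndependent K (fun s : mixed n k => (B K n s.1 : HT K n)) :=
    (B K n).linearIndependent.comp (fun s : mixed n k => s.1) fun s s' h => Subtype.ext h
  have hle : Submodule.span K (Set.range fun s : mixed n k => (B K n s.1 : HT K n)) ≤
      (LinearMap.ker (wedgeMap K n k (pointPair K n a c))).map (⋀[K]^k (N K n)).subtype := by
    rw [Submodule.span_le]
    rintro _ ⟨⟨s, hs⟩, rfl⟩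
    have hmem : (B K n s : HT K n) ∈ ⋀[K]^k (N K n) := B_mem_exteriorPower K ⟨s, mem_iff.mpr (mem_mixed.mp hs).1⟩
    refine ⟨⟨B K n s, hmem⟩, ?_, rfl⟩
    rw [SetLike.mem_coe, LinearMap.mem_ker, wedgeMap_apply]
    exact B_mul_pointPair_eq_zero_of_mixed K a c hs
  refine (Submodule.eq_of_le_of_finrank_eq hle ?_).symm
  rw [finrank_span_eq_card hli, Fintype.card_coe, Submodule.finrank_map_subtype_eq]
  have h1 := LinearMap.finrank_range_add_finrank_ker (wedgeMap K n k (pointPair K n a c))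
  rw [finrank_range_wedgeMap_pointPair_mid K hk hkn ha hc, exteriorPower.finrank_eq, finrank_fintype_fun_eq_card,
    Fintype.card_fin, ← card_mixed_add (n := n) hk, add_comm] at h1
  exact (Nat.add_right_cancel h1).symm

/-- **degree 2: the mixed pairs are the `n²` products `x ∧ y`** (`x ∈ X`, `y ∈ Y`): «H⁰(T_X) ⊗ H¹(𝒪_X) = H¹(T_X)», STRUCTURE C6's
factor kernel `n²` («(dim HT², rank ⌟κ, ker) = (2n²−n, n(n−1), n²)»), for every `n`. -/
theorem card_mixed_two : (mixed n 2).card = n * n := by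
  rcases Nat.eq_zero_or_pos n with rfl | hn
  · decide
  · have h := card_mixed_add (n := n) (k := 2) (by omega)
    have h2 : (n + n).choose 2 = 2 * n.choose 2 + n * n := by
      have key : (((n + n).choose 2 : ℕ) : ℚ) = ((2 * n.choose 2 + n * n : ℕ) : ℚ) := by
        push_cast
        rw [Nat.cast_choose_two, Nat.cast_choose_two]
        push_cast
        ring
      exact_mod_cast key
    omega

end Summit.Ventures.HSemireg.WedgePair
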